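import Literature.MathematicalPhysics.QuantumFieldTheory.Balaban1983to89.B8Prop6CubeMemberGaugedReal

/-!
# `Balaban1983to89.B8Prop6CubB8OfRecordReal` — [Balaban1985RegularSpaces] PROPOSITION 6 (p. 99) AS `B8.Prop6Printed` ON NODE 00's MEMBER OF RECORD
# `Node00.cubB8OfRecord θ`, IN THE REAL CURRENCY — the `p6` letter of a pin face at the located layer `lam.withCub`, per cube: three families of REAL
# inequalities on the explicit matrices of the flat [4]-letters on `□₀` and (1.59) for `G(1)` (`B8Prop6CubeMemberGaugedFlat.prop6Printed_cubB8OfRecord_flat₃`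
# re-run on `B8Prop6CubeMemberGaugedReal.prop6Printed_zdCub_real₃` at `f := Subtype.val`)

statement-level skeleton of published theorems with citation tags; proofs where landed; nothing here is a claim about the
Yang–Mills mass gap

`[Balaban1985RegularSpaces]` ("B8", CMP **99** (1985) 75–102) Prop. 6 p. 99, Thm 4 p. 88, Prop. 3 p. 87, Prop. 5 p. 94, (1.59) p. 86, (1.92) p. 91, (1.98) p. 92,
(1.101) p. 93; [4] = `[Balaban1985BackgroundPropagators]` Thms 3.1–3.3 pp. 397–398.

CITATION HEADER (lean-in-tree rule).  Cell `pub-ymgap` (YM Track A, HUMAN RULING D-0062), DAG node N05 = [B8], seat `pub-ymgap-dag-n05-e` (g4; director-ym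
R141 (C), FAN-OUT §N05 row s3b — THE FLAT CURRENCY for Proposition 6).  Companion of `B8Prop6CubeMemberGaugedReal` (§3 of g2's
`B8Prop6CubeMemberGaugedFlat` in the real currency, filed separately for the 400-line rule): ★ `prop6Printed_cubB8OfRecord_real₃` — `B8.Prop6Printed` on
`Node00.cubB8OfRecord θ` (`θ.D ≥ 2`, `B₁ := 5·θ.D·θ.L·B₀`) from, per cube of every member of NODE 00's index `IdxB8 θ`: the five-member (1.59) body for
`G(1)` at the top truncation, and for every admissible `(U₀, α₀)` SOME weights `w ≥ 0` with the three REAL inequality families at every truncation +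
Theorem 4's two-member (1.59) clause.  For a cut layer `lam.withCubOn P` take `prop6Printed_zdCub_real₃` at `f := fun i : {i ∕∕ P i} => i.1.1`.

HONEST SCOPE.  A one-line instantiation; nothing of [4] is proved (displayed hypotheses); the standing relation `3·2dL²·B_G·B_R ≤ B₀′` is displayed.
Count-neutral; N05 NOT discharged; one finite `T⁴` programme at fixed `ε`, Bałaban as printed; nothing continuum ∕ ℝ⁴ ∕ OS ∕ mass-gap ∕ Clay.  No `sorry`,
no `def`, no `instance`, no `notation`.  Unit `pub-ymgap-dag-n05-e` (g4), 2026-08-27.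
-/

noncomputable section

open NormedSpace

namespace Literature.MathematicalPhysics.QuantumFieldTheory.Balaban1983to89.B8Prop6CubB8OfRecordReal

open scoped Matrix
open MatrixLog B7Prop1Explicit B7Prop2Explicit B7Prop1Local B7Eq92Concrete
open B7Prop4GeneralLevels (logCovIter linCovIter)
open B8Ineq132 (covDerivFwd InAk)
open B8Ineq133 (cutFixed)
open B8Lemma1NonAbelian (mulCfg)
open B8Eq119TwistedAxial (InAx Restr129)
open B8Eq140Level (SideTouches)
open B8Eq143PlaqExpansion (pdiv)
open B8Eq146AExpansion (iEta plaqCovDeriv)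
open B8Eq155JBound (Jcur wsup)
open B8ScaledSupNorm (bondNorm msup)
open B8Eq184Proof (gaugeExp cfgExp)
open B8Eq138LandauZd (IsLandau138W logCfg covLap)
open B8LambdaSpaceKLevel (wt)
open B8Eq131Cubes (tcube tLo tHi ctr)
open B8Eq131CubesAdmissible (cubeFam)
open B8CubeMemberZd (cubeLamS cubeLamB)
open B9Eq340HolderZd (hquot AdmPair)
open B8Prop6CubeMemberGaugedReal (prop6Printed_zdCub_real₃)
open Node00 (CubeB8 zdCub)
open Literature.MathematicalPhysics.QuantumLattice (blockMap)

export B7Prop1Explicit (Site)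

open Classical in
/-- **`B8.Prop6Printed` ON NODE 00's MEMBER OF RECORD `Node00.cubB8OfRecord θ` FROM THE REAL FAMILIES** — `prop6Printed_zdCub_real₃` at `f := Subtype.val`
(the `p6` letter of a pin face at the located layer `lam.withCub`), `θ.D ≥ 2`, `B₁ := 5·θ.D·θ.L·B₀`: per cube, the five-member (1.59) body for `G(1)` at the top
truncation, and for every admissible `(U₀, α₀)` SOME weights `w ≥ 0` with (1.101) for `T⁻¹`, (1.92) + the p. 93 `Δ`-entry for `T⁻¹(T⁻¹Qᵀ)(QT⁻¹T⁻¹Qᵀ)⁻¹`,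
(1.98) for `1 − T⁻¹Qᵀ(QT⁻¹T⁻¹Qᵀ)⁻¹QT⁻¹` (real lattice functions, every truncation) and Theorem 4's two-member (1.59) clause.
[cite: Balaban1985RegularSpaces, Prop. 6 p.99, Thm 4 p.88 (existence), Prop. 3 p.87, (1.92) p.91, (1.98) p.92, (1.101) p.93, (1.59) p.86] -/
theorem prop6Printed_cubB8OfRecord_real₃ (θ : Node00.Stage3Params) (hD : 2 ≤ θ.D) {B₀ B₀' B₀β C₂ cB9 B₀'H B₂' BG BR : ℝ} (hB₀ : 0 < B₀)
    (hB₀' : 0 < B₀') (hB : 2 ≤ 5 * (θ.D : ℝ) * θ.L * B₀) (hB₀β : 0 ≤ B₀β) (hC₂ : 2097152 * ((θ.D : ℝ) + 1) ^ 2 ≤ C₂) (hcB9 : 0 < cB9)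
    (hB₀'H : 0 < B₀'H) (hB₂' : 0 ≤ B₂') (hBG : 0 ≤ BG) (hBR : 0 ≤ BR) (hfree : 3 * (2 * (θ.D : ℝ) * (θ.L : ℝ) ^ 2) * BG * BR ≤ B₀')
    (β : ℝ) (len : Site θ.D → ℝ) :
    ∃ c₁ : ℝ, 0 < c₁ ∧
      ((∀ (i : Node00.IdxB8 θ) (c : CubeB8 θ.D θ.L i.1.k i.1.Ω),
      (∀ α₀' α₂ : ℝ, 0 < α₀' → α₀' ≤ cB9 → 0 < α₂ → α₂ ≤ cB9 →
        ∀ (W : Site θ.D → Fin θ.D → θ.𝔸ˣ), (∀ x κ, W x κ ∈ unitaryUnits θ.𝔸) →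
        InAk θ.L c.k i.1.η α₀' (cubeFam false θ.L c.a c.M c.ρ c.k) (1 : Site θ.D → Fin θ.D → θ.𝔸ˣ) → InAk θ.L c.k i.1.η α₀' (cubeFam false θ.L c.a c.M c.ρ c.k) (mulCfg W (1 : Site θ.D → Fin θ.D → θ.𝔸ˣ)) →
        IsLandau138W θ.L c.k i.1.η (cubeFam false θ.L c.a c.M c.ρ c.k 0) (cubeLamS θ.L c.a c.M c.ρ c.k c.k) (1 : Site θ.D → Fin θ.D → θ.𝔸ˣ) W →
        ∀ A' : Site θ.D → Fin θ.D → θ.𝔸, (∀ y τ, IsSelfAdjoint (A' y τ)) →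
        (∀ j, j ≤ c.k → ∀ (y : Site θ.D) (τ : Fin θ.D), SideTouches (cubeFam false θ.L c.a c.M c.ρ c.k j) y τ →
          W y τ = cfgExp i.1.η A' y τ ∧ ‖A' y τ‖ ≤ α₂ * ((θ.L : ℝ) ^ j * i.1.η)⁻¹) →
        (∀ (y : Site θ.D) (τ : Fin θ.D), (∀ j, j ≤ c.k → ¬ SideTouches (cubeFam false θ.L c.a c.M c.ρ c.k j) y τ) → A' y τ = 0) →
        msup θ.L c.k i.1.η (-(1 : ℝ)) (fun j (b : Site θ.D × Fin θ.D) => SideTouches (cubeFam false θ.L c.a c.M c.ρ c.k j) b.1 b.2) (fun b => A' b.1 b.2)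
            ≤ B₀ * (bondNorm θ.L c.k i.1.η (-(3 : ℝ)) (cubeFam false θ.L c.a c.M c.ρ c.k) (fun x μ => Jcur i.1.η (1 : Site θ.D → Fin θ.D → θ.𝔸ˣ) A' μ x)
              + wsup 1 (fun p : {p : ℕ × (Site θ.D × Fin θ.D) // p.1 ≤ c.k ∧ p.2 ∈ cubeLamB θ.L c.a c.M c.ρ c.k c.k p.1} =>
                  linCovIter θ.L (1 : Site θ.D → Fin θ.D → θ.𝔸ˣ) (iEta i.1.η A') p.1.1 p.1.2.1 p.1.2.2)) ∧
          msup θ.L c.k i.1.η (-(2 : ℝ)) (fun j (t : Fin θ.D × Fin θ.D × Site θ.D) => SideTouches (cubeFam false θ.L c.a c.M c.ρ c.k j) t.2.2 t.2.1)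
              (fun t => covDerivFwd i.1.η (1 : Site θ.D → Fin θ.D → θ.𝔸ˣ) t.1 (fun z => A' z t.2.1) t.2.2)
            ≤ B₀ * (bondNorm θ.L c.k i.1.η (-(3 : ℝ)) (cubeFam false θ.L c.a c.M c.ρ c.k) (fun x μ => Jcur i.1.η (1 : Site θ.D → Fin θ.D → θ.𝔸ˣ) A' μ x)
              + wsup 1 (fun p : {p : ℕ × (Site θ.D × Fin θ.D) // p.1 ≤ c.k ∧ p.2 ∈ cubeLamB θ.L c.a c.M c.ρ c.k c.k p.1} =>
                  linCovIter θ.L (1 : Site θ.D → Fin θ.D → θ.𝔸ˣ) (iEta i.1.η A') p.1.1 p.1.2.1 p.1.2.2)) ∧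
          bondNorm θ.L c.k i.1.η (-(3 : ℝ)) (cubeFam false θ.L c.a c.M c.ρ c.k) (fun x μ => pdiv i.1.η (1 : Site θ.D → Fin θ.D → θ.𝔸ˣ) (plaqCovDeriv i.1.η (1 : Site θ.D → Fin θ.D → θ.𝔸ˣ) A') μ x)
            ≤ B₀ * (bondNorm θ.L c.k i.1.η (-(3 : ℝ)) (cubeFam false θ.L c.a c.M c.ρ c.k) (fun x μ => Jcur i.1.η (1 : Site θ.D → Fin θ.D → θ.𝔸ˣ) A' μ x)
              + wsup 1 (fun p : {p : ℕ × (Site θ.D × Fin θ.D) // p.1 ≤ c.k ∧ p.2 ∈ cubeLamB θ.L c.a c.M c.ρ c.k c.k p.1} =>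
                  linCovIter θ.L (1 : Site θ.D → Fin θ.D → θ.𝔸ˣ) (iEta i.1.η A') p.1.1 p.1.2.1 p.1.2.2)) ∧
          bondNorm θ.L c.k i.1.η (-(3 : ℝ)) (cubeFam false θ.L c.a c.M c.ρ c.k) (fun x μ => covLap i.1.η (1 : Site θ.D → Fin θ.D → θ.𝔸ˣ) (fun z => A' z μ) x)
            ≤ B₀ * (bondNorm θ.L c.k i.1.η (-(3 : ℝ)) (cubeFam false θ.L c.a c.M c.ρ c.k) (fun x μ => Jcur i.1.η (1 : Site θ.D → Fin θ.D → θ.𝔸ˣ) A' μ x)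
              + wsup 1 (fun p : {p : ℕ × (Site θ.D × Fin θ.D) // p.1 ≤ c.k ∧ p.2 ∈ cubeLamB θ.L c.a c.M c.ρ c.k c.k p.1} =>
                  linCovIter θ.L (1 : Site θ.D → Fin θ.D → θ.𝔸ˣ) (iEta i.1.η A') p.1.1 p.1.2.1 p.1.2.2)) ∧
          msup θ.L c.k i.1.η (-(2 + β)) (fun j (q : Fin θ.D × Fin θ.D × (Site θ.D × Site θ.D)) => q.2.2 ∈ AdmPair i.1.η len ∧ q.2.2.1 ∈ cubeFam false θ.L c.a c.M c.ρ c.k j)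
              (fun q => hquot i.1.η β len (1 : Site θ.D → Fin θ.D → θ.𝔸ˣ) (covDerivFwd i.1.η (1 : Site θ.D → Fin θ.D → θ.𝔸ˣ) q.1 (fun z => A' z q.2.1)) q.2.2)
            ≤ B₀β * (bondNorm θ.L c.k i.1.η (-(3 : ℝ)) (cubeFam false θ.L c.a c.M c.ρ c.k) (fun x μ => Jcur i.1.η (1 : Site θ.D → Fin θ.D → θ.𝔸ˣ) A' μ x)
              + wsup 1 (fun p : {p : ℕ × (Site θ.D × Fin θ.D) // p.1 ≤ c.k ∧ p.2 ∈ cubeLamB θ.L c.a c.M c.ρ c.k c.k p.1} =>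
                  linCovIter θ.L (1 : Site θ.D → Fin θ.D → θ.𝔸ˣ) (iEta i.1.η A') p.1.1 p.1.2.1 p.1.2.2))) ∧
      ∀ (U₀ : Site θ.D → Fin θ.D → θ.𝔸ˣ), (∀ x κ, U₀ x κ ∈ unitaryUnits θ.𝔸) → ∀ (α₀ : ℝ), 0 < α₀ → InAk θ.L i.1.k i.1.η α₀ i.1.Ω U₀ →
      (∃ w : ℕ → ℝ, (∀ j, 0 ≤ w j) ∧
      (∀ n, 1 ≤ n → n ≤ c.k → ∀ (S : Finset (Site θ.D)), (∀ x, x ∈ S ↔ x ∈ cubeFam false θ.L c.a c.M c.ρ c.k 0) →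
        ∀ (B : Finset (ℕ × Site θ.D)), (∀ p, p ∈ B ↔ p.1 ≤ n ∧ p.2 ∈ cubeLamS θ.L c.a c.M c.ρ c.k n p.1) →
        ∀ (K : Site θ.D → Site θ.D → ℝ), (∀ x z, K x z =
          ((i.1.η ^ 2)⁻¹ * ∑ μ : Fin θ.D, ((2 : ℝ) * (if z = x then (1 : ℝ) else 0) - (if z = x + e μ then (1 : ℝ) else 0)
            - (if z = x - e μ then (1 : ℝ) else 0))) +
          (∑ j ∈ Finset.range (n + 1), (if blockMap (θ.L ^ j) x ∈ cubeLamS θ.L c.a c.M c.ρ c.k n j ∧ blockMap (θ.L ^ j) z = blockMap (θ.L ^ j) x then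
            w j * ((((θ.L : ℝ) ^ θ.D)⁻¹) ^ j) ^ 2 else 0))) →
        ∀ (T : Matrix ↥S ↥S ℝ), T = Matrix.of (fun x z : ↥S => K x.1 z.1) →
        ∀ (Q : Matrix ↥B ↥S ℝ), Q = Matrix.of (fun (p : ↥B) (z : ↥S) =>
          if blockMap (θ.L ^ p.1.1) z.1 = p.1.2 then (((θ.L : ℝ) ^ θ.D)⁻¹) ^ p.1.1 else 0) →
        (∀ (ρ' : ↥S → ℝ) (r : ℝ), 0 ≤ r →
          (∀ j, j ≤ n → ∀ z : ↥S, z.1 ∈ cubeFam false θ.L c.a c.M c.ρ c.k j → wt θ.L i.1.η j ^ 2 * |ρ' z| ≤ r) →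
          ∀ φ : Site θ.D → ℝ, (∀ x, x ∉ cubeFam false θ.L c.a c.M c.ρ c.k 0 → φ x = 0) → (∀ v : ↥S, φ v.1 = ∑ z : ↥S, T⁻¹ v z * ρ' z) →
          (∀ x, |φ x| ≤ BG * r) ∧
          ∀ j, j ≤ n → ∀ p ∈ {b : Site θ.D × Fin θ.D | SideTouches (cubeFam false θ.L c.a c.M c.ρ c.k j) b.1 b.2},
            wt θ.L i.1.η j * |(i.1.η)⁻¹ * (φ (p.1 + e p.2) - φ p.1)| ≤ BG * r) ∧
        (∀ (X : ↥B → ℝ) (s : ℝ), 0 ≤ s → (∀ p', |X p'| ≤ s) →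
          ∀ φ : Site θ.D → ℝ, (∀ x, x ∉ cubeFam false θ.L c.a c.M c.ρ c.k 0 → φ x = 0) →
          (∀ v : ↥S, φ v.1 = ∑ p' : ↥B, (T⁻¹ * (T⁻¹ * Qᵀ) * (Q * T⁻¹ * T⁻¹ * Qᵀ)⁻¹) v p' * X p') →
          (∀ x, |φ x| ≤ B₀'H * s) ∧
          (∀ j, j ≤ n → ∀ p ∈ {b : Site θ.D × Fin θ.D | SideTouches (cubeFam false θ.L c.a c.M c.ρ c.k j) b.1 b.2},
            wt θ.L i.1.η j * |(i.1.η)⁻¹ * (φ (p.1 + e p.2) - φ p.1)| ≤ B₀'H * s) ∧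
          (∀ j, j ≤ n → ∀ x ∈ cubeFam false θ.L c.a c.M c.ρ c.k j,
            wt θ.L i.1.η j ^ 2 * |∑ μ : Fin θ.D, (i.1.η ^ 2)⁻¹ * (2 * φ x - φ (x + e μ) - φ (x - e μ))| ≤ B₂' * s)) ∧
        (∀ (ρ' : ↥S → ℝ) (r : ℝ), 0 ≤ r →
          (∀ j, j ≤ n → ∀ z : ↥S, z.1 ∈ cubeFam false θ.L c.a c.M c.ρ c.k j → wt θ.L i.1.η j ^ 2 * |ρ' z| ≤ r) →
          ∀ j, j ≤ n → ∀ v : ↥S, v.1 ∈ cubeFam false θ.L c.a c.M c.ρ c.k j →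
            wt θ.L i.1.η j ^ 2 * |ρ' v - ∑ z : ↥S, (T⁻¹ * (Qᵀ * ((Q * T⁻¹ * T⁻¹ * Qᵀ)⁻¹ * (Q * T⁻¹)))) v z * ρ' z| ≤ BR * r))) ∧
      ((∀ m, 1 ≤ m → m ≤ c.k → ∀ (u : Site θ.D → θ.𝔸ˣ) (W : Site θ.D → Fin θ.D → θ.𝔸ˣ) (A' : Site θ.D → Fin θ.D → θ.𝔸),
        (∀ x, u x ∈ unitaryUnits θ.𝔸) → mgauge (1 : Site θ.D → Fin θ.D → θ.𝔸ˣ) u W = (cutFixed θ.L (tLo c.a c.ρ) (tHi c.a c.M c.ρ) U₀ c.k (ctr c.a c.M)) →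
          Restr129 θ.L m ((cubeLamS θ.L c.a c.M c.ρ c.k) m) (1 : Site θ.D → Fin θ.D → θ.𝔸ˣ) u →
          IsLandau138W θ.L m i.1.η ((cubeFam false θ.L c.a c.M c.ρ c.k) 0) ((cubeLamS θ.L c.a c.M c.ρ c.k) m) (1 : Site θ.D → Fin θ.D → θ.𝔸ˣ) W →
        (∀ y τ, IsSelfAdjoint (A' y τ)) →
        (∀ j, j ≤ m → ∀ y τ, SideTouches ((cubeFam false θ.L c.a c.M c.ρ c.k) j) y τ →
        W y τ = cfgExp i.1.η A' y τ ∧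
          ‖A' y τ‖ ≤ (2 * (θ.L * (5 * (θ.D : ℝ) * θ.L * B₀ * (((θ.L : ℝ) ^ 3 * α₀) + (6 * (θ.D : ℝ) * (θ.L : ℝ) ^ 2 * c.M * α₀)))) + 8 * (8 * B₀' * (5 * (θ.D : ℝ) * θ.L * B₀) * (((θ.L : ℝ) ^ 3 * α₀) + (6 * (θ.D : ℝ) * (θ.L : ℝ) ^ 2 * c.M * α₀)))) * ((θ.L : ℝ) ^ j * i.1.η)⁻¹) →
        (∀ y τ, (∀ j, j ≤ m → ¬ SideTouches ((cubeFam false θ.L c.a c.M c.ρ c.k) j) y τ) → A' y τ = 0) →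
        msup θ.L m i.1.η (-(1 : ℝ)) (fun j (b : Site θ.D × Fin θ.D) => SideTouches ((cubeFam false θ.L c.a c.M c.ρ c.k) j) b.1 b.2) (fun b => A' b.1 b.2)
        ≤ B₀ * (bondNorm θ.L m i.1.η (-(3 : ℝ)) (cubeFam false θ.L c.a c.M c.ρ c.k) (fun x μ => Jcur i.1.η (1 : Site θ.D → Fin θ.D → θ.𝔸ˣ) A' μ x)
        + wsup 1 (fun p : {p : ℕ × (Site θ.D × Fin θ.D) // p.1 ≤ m ∧ p.2 ∈ (cubeLamB θ.L c.a c.M c.ρ c.k) m p.1} =>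
        linCovIter θ.L (1 : Site θ.D → Fin θ.D → θ.𝔸ˣ) (iEta i.1.η A') p.1.1 p.1.2.1 p.1.2.2)) ∧
        msup θ.L m i.1.η (-(2 : ℝ)) (fun j (t : Fin θ.D × Fin θ.D × Site θ.D) => SideTouches ((cubeFam false θ.L c.a c.M c.ρ c.k) j) t.2.2 t.2.1)
        (fun t => covDerivFwd i.1.η (1 : Site θ.D → Fin θ.D → θ.𝔸ˣ) t.1 (fun z => A' z t.2.1) t.2.2)
        ≤ B₀ * (bondNorm θ.L m i.1.η (-(3 : ℝ)) (cubeFam false θ.L c.a c.M c.ρ c.k) (fun x μ => Jcur i.1.η (1 : Site θ.D → Fin θ.D → θ.𝔸ˣ) A' μ x)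
        + wsup 1 (fun p : {p : ℕ × (Site θ.D × Fin θ.D) // p.1 ≤ m ∧ p.2 ∈ (cubeLamB θ.L c.a c.M c.ρ c.k) m p.1} =>
        linCovIter θ.L (1 : Site θ.D → Fin θ.D → θ.𝔸ˣ) (iEta i.1.η A') p.1.1 p.1.2.1 p.1.2.2))))) →
      B8.Prop6Printed θ.D (θ.L : ℝ) (5 * (θ.D : ℝ) * θ.L * B₀) c₁ (Node00.cubB8OfRecord θ)) := by
  obtain ⟨c₁, hc₁, G⟩ := prop6Printed_zdCub_real₃ (𝔸 := θ.𝔸) hD θ.two_le_L hB₀ hB₀' hB hB₀β hC₂ hcB9 hB₀'H hB₂' hBG hBR hfree β len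
  exact ⟨c₁, hc₁, fun S => G (fun i : Node00.IdxB8 θ => i.1) S⟩

#print axioms prop6Printed_cubB8OfRecord_real₃

end Literature.MathematicalPhysics.QuantumFieldTheory.Balaban1983to89.B8Prop6CubB8OfRecordReal

end
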